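import Mathlib
import Literature.MathematicalPhysics.QuantumFieldTheory.Balaban1983to89.B13

/-!
# `Balaban1983to89.B13ScaleTransfer` — [Balaban1988RG2Cluster] p. 19, the scale-transfer inequality (2.36)
"2d_k(Z_i) ≧ Ld_{k+1}(Z′_i)": a KERNEL-CHECKED SUBSTITUTE with explicit constants, from three published tree-length
lemmas of Dimock's exposition [Dimock2013] / [Dimock2013BalabanII] entered as quoted leaves, plus the modified closing
bookkeeping of p. 21

CITATION HEADER (lean-in-tree rule 2026-08-18).  Source under audit: T. Bałaban, *Renormalization group approach to
lattice gauge field theories. II. Cluster expansions*, Commun. Math. Phys. **116**, 1–22 (1988) [Balaban1988RG2Cluster]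
(cell paper B13; held `paper:balaban1988-cmp116-rg-ii-cluster`, journal page = PDF page; quotations read from the
page renders p. 19–21 via the sub-cell transcript `HOME/b2b-balaban-b13/transcript-B13.md`).  Cited published inputs:
J. Dimock, *The renormalization group according to Balaban. I. Small fields*, Rev. Math. Phys. **25** (2013) 1330010
[Dimock2013] (held as `paper:arxiv-1108.1335`; loci below = section / lemma numbers, TeX chunk p0012 / p0020 of the held
text) and *II. Large fields*, J. Math. Phys. **54** (2013) 092301 [Dimock2013BalabanII] (held `paper:arxiv-1212.5562`,
Appendix E, chunk p0054); the cube conventions of [Balaban1987RG1] p. 257.  Satellite of the sibling module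
`…Balaban1983to89.B13` (units r2 / b13), which it imports and does not modify; cell GAPS.md row G-B13-09, TEMPLATE.md
v4 §15.1 G4 / §15.2 ("kernel candidate … b13's call"); unit `b2b-balaban-pv11` (surge node prover #11).

WHAT THE PAPER PRINTS (p. 19 [19], verbatim): *"We extract exp(−δκd_k(Z_i)) from each exponential in (2.35) … The
remaining exponential is bounded using the following inequality: 2d_k(Z_i) ≧ Ld_{k+1}(Z′_i). (2.36) This inequality
can be obtained by simple, but awkward, geometric and combinatoric considerations. It follows by considering locally
many possible cases."*  Here Z_i is a connected component (a localization domain from 𝐃_k), Z̃_i is Z_i with one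
layer of M-cubes adjoined ([Balaban1987RG1] p. 257: *"For a cube □ ∈ π_j and n = 1, 2, … we define □̃ⁿ as a cube of
the size (1 + 2n)M and with a center at the center of □. … The meaning of the symbol X̃ⁿ should be obvious"*), and
(p. 19, verbatim) *"we denote by Z′_i the smallest localization domain from 𝐃_{k+1} containing Z̃_i"* (p. 13: *"we
take cubes from π_{k+1}, i.e. cubes of the size LM in the scale corresponding to the lattice T_η … Z′₀ is a union of
the smallest family of such cubes containing Z̃₀"*).  (2.36) is THE scale-transfer step of §2: it turns the
rate (1 − 6δ)κ in d_k into (1 − 6δ)½Lκ in d_{k+1} ((2.37) p. 20), whence Lemma 3 (2.38), (2.41) and the closing choice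
p. 21 *"we assume that (1 − 10δ)½L = 1"* giving (I.1.18) with rate κ (`B13.bound118_of_bound241`).  Cell finding
G-B13-09 (sub-cell b13): (2.36) is UNPROVED in print, FALSE for small L (L = 3, Z_i = □̃), no counterexample known for
the L in force (B12 p. 251: L odd > 11), general case "not derivable from the text".

WHAT IS REPRODUCED HERE (kernel-checked).  Part 1 — a CONCRETE model of the cube combinatorics: cubes of π_k ↔ index
points of ℤ^d (`Pt d`), face-adjacency (common (d−1)-dimensional wall, [Balaban1987RG1] p. 257) `Adj`,
face-connectedness `FaceConnected`, the adjoining operation `collar` (= X ↦ X̃), the coarse cubes of π_{k+1} as blocks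
of L^d cubes (`coarse`, `closureIdx` = Z ↦ the index set of the smallest union of π_{k+1}-cubes containing Z), with
the lattice facts PROVED: `card_collar_sdiff_le` (|X̃ ∖ X| ≤ (3^d − 1)|X|), `faceConnected_collar` (X̃ is a
localization domain when X is), `coarse_eq_iff` (the block of index b is {x : Lb_μ ≤ x_μ < L(b_μ + 1)}),
`faceConnected_closureIdx` / `faceConnected_closure` (the smallest family of π_{k+1}-cubes containing a localization
domain, resp. containing Z̃, is connected — so Z′ is a localization domain from 𝐃_{k+1}, as p. 19 says).  Part 2 —
the TREE LENGTH is NOT formalised (continuum Steiner trees; cell DIVERGENCE F5): it is an arbitrary function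
`tl : Finset (Pt d) → ℝ` on index sets (scale-free, as [Balaban1987RG1] p. 257 defines d_j: *"we rescale the space, so
that cubes from π_j become unit cubes, and we take the distance in this scale"*; [Dimock2013] §3: *"d_{LM}(LX) =
d_M(X)"*), about which exactly three PUBLISHED, PROVED statements are entered as named leaf `Prop`s quoting their
source verbatim: `CoarseningLeaf` ([Dimock2013] proof of Lemma 10, first sentence), `AdjoinLeaf` ([Dimock2013]
Lemma 20), and [Dimock2013BalabanII] Lemma E.1 (1), (3) with the preamble remark ℓ̃_M ≤ d_M (`SteinerLeaf`,
`VolumeLeaf`, `InsideLeaf`, over two further abstract lengths ℓ, ℓ̃).  Part 3 — the chain (TEMPLATE.md §15.1 G4(b))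
PROVED from the leaves: for every localization domain Z, `L·d_{k+1}(Z′) ≤ A_d·d_k(Z) + B_d` (`scaleTransfer_of_leaves`)
with `Acoef d = 1 + 8(3^d − 1)(2^d + 1)`, `Bcoef d = 4(3^d − 1)(2^d + 1)` (d = 4: 10881 and 5440, `Acoef_four`,
`Bcoef_four`; 2B_d < A_d, `two_Bcoef_lt_Acoef`), and its exponential form as used on p. 19–20
(`exp_transfer`, `exp_transfer_four`: e^{−a d_k(Z)} ≤ e^{a/2}·e^{−(aL/10881) d_{k+1}(Z′)} for a ≥ 0).  Part 4 — the
p. 21 closing bookkeeping with the substitute factor: `R22subst` ("(1 − 10δ)L/A ≥ 1" in place of the printed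
"(1 − 10δ)½L = 1"), `bound118_of_substRate` ((2.41) with rate (1 − 10δ)(L/A)κ ∧ `R22subst` ∧ the constant ≤ ½E₀ ⇒
(I.1.18) with ½E₀ and rate κ; the printed case is A = 2, `R22subst_two_of_R22`), and the PRICE made explicit:
`R22subst` with δ > 0 forces L > A (`lt_L_of_R22subst`; d = 4: L ≥ 10882, `R22subst_four_forces`, versus B12's
"L > 11"), while it IS satisfiable in B12's class of L (`R22subst_four_witness`: L = 21763 odd, δ = 1/20).

WHAT IS *NOT* REPRODUCED OR ASSERTED.  (2.36) itself (typed for the record as `Ineq236Printed`, never used); the truth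
of the three leaves for Bałaban's d_k (they are hypotheses; [Dimock2013] states Lemma 10 / Lemma 20 in its d = 3
setting — the quoted arguments use no property of the dimension, which is this module's READING recorded in cell
GAPS.md, not a certification; [Dimock2013BalabanII] Lemma E.1 is stated "in a lattice of dimension d"; the metric of
the tree length is not named in [Balaban1987RG1] — cell DIVERGENCE D-T2 — and the three quoted arguments hold for the
ℓ¹, ℓ² and ℓ^∞ lengths alike); that pp. 19–21 of the paper go through with ½L replaced by L/A_d and ε₂ replaced by
ε₂e^{κ/2} (the reader's claim, GAPS.md G-B13-09 annotation C-pv11-1); anything about the series.  Value = located-gap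
repair bookkeeping with explicit constants, NOT summit progress.

Revision v3 (docstring-only, after the cross-read GAPS C-pv10-6): p. 262 quotation of X̃⁻² completed verbatim; the (2.36) ⇒ (2.37)
step of `exp_transfer_four` marked as our formula rendering of the printed words. No declaration changed.
-/

namespace Literature.MathematicalPhysics.QuantumFieldTheory.Balaban1983to89.B13ScaleTransfer

noncomputable section

open Literature.MathematicalPhysics.QuantumFieldTheory.Balaban1983to89

/-! ## Part 1. Cubes of one partition π_k as index points of ℤ^d; walls, localization domains, X̃, π_{k+1}-blocks -/

/-- Index set of the cubes of a partition π_k: the cube of index x is [x, x + 1]^d after the rescaling of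
[Balaban1987RG1] p. 257 (*"we rescale the space, so that cubes from π_j become unit cubes"*). [cite: Balaban1987RG1, p.257 (localization domains)] -/
abbrev Pt (d : ℕ) := Fin d → ℤ

variable {d : ℕ}

/-- Two cubes have a common wall ([Balaban1987RG1] p. 257, verbatim: *"two consecutive cubes have a common wall, i.e.
their intersection is a d−1-dimensional cube"*) iff their indices differ by a unit vector: y = x ± e_i. [cite: Balaban1987RG1, p.257 (localization domains)] -/
def Adj (x y : Pt d) : Prop :=
  ∃ i : Fin d, y = Function.update x i (x i + 1) ∨ x = Function.update y i (y i + 1)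

/-- Having a common wall is symmetric. [folklore] -/
theorem Adj.symm {x y : Pt d} (h : Adj x y) : Adj y x := by
  obtain ⟨i, h | h⟩ := h
  · exact ⟨i, Or.inr h⟩
  · exact ⟨i, Or.inl h⟩

/-- The cube x + e_i has a common wall with the cube x. [folklore] -/
theorem adj_update_add_one (x : Pt d) (i : Fin d) : Adj x (Function.update x i (x i + 1)) :=
  ⟨i, Or.inl rfl⟩

/-- The cube x − e_i has a common wall with the cube x. [folklore] -/
theorem adj_update_sub_one (x : Pt d) (i : Fin d) : Adj x (Function.update x i (x i - 1)) := by
  refine ⟨i, Or.inr ?_⟩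
  simp [Function.update_idem]

/-- One step of a chain of cubes inside the family `S` (both cubes in `S`, common wall). [cite: Balaban1987RG1, p.257 (localization domains)] -/
def StepIn (S : Finset (Pt d)) (a b : Pt d) : Prop := a ∈ S ∧ b ∈ S ∧ Adj a b

/-- Chain-connectedness of two cubes inside `S` (reflexive–transitive closure of `StepIn S`). [cite: Balaban1987RG1, p.257 (localization domains)] -/
def Linked (S : Finset (Pt d)) : Pt d → Pt d → Prop := Relation.ReflTransGen (StepIn S)

/-- [Balaban1987RG1] p. 257, verbatim: *"A connected family means that for every pair □, □′ of cubes from the family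
there exists a sequence □, □₁, …, □_n, □′ of cubes belonging to the family and such that two consecutive cubes have
a common wall"* (= [Dimock2013] §3: *"connected means that for any two cubes □, □′ in X there is a sequence
□ = □₀, □₁, □₂, …, □_m = □′ such that □_j ⊂ X and □_j and □_{j+1} have a (d−1) = 2 dimensional face in common"*).
A localization domain from 𝐃_k is a non-empty finite family with this property. [cite: Balaban1987RG1, p.257 (localization domains)] -/
def FaceConnected (S : Finset (Pt d)) : Prop := ∀ x ∈ S, ∀ y ∈ S, Linked S x y

/-- Chain-connectedness inside `S` is symmetric (chains can be reversed). [folklore] -/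
theorem Linked.symm {S : Finset (Pt d)} {x y : Pt d} (h : Linked S x y) : Linked S y x := by
  unfold Linked at *
  induction h with
  | refl => exact Relation.ReflTransGen.refl
  | tail _ hbc ih => exact Relation.ReflTransGen.head ⟨hbc.2.1, hbc.1, hbc.2.2.symm⟩ ih

/-- Chain-connectedness inside `S` is transitive (chains concatenate). [folklore] -/
theorem Linked.trans {S : Finset (Pt d)} {x y z : Pt d} (h₁ : Linked S x y) (h₂ : Linked S y z) : Linked S x z :=
  Relation.ReflTransGen.trans h₁ h₂

/-- A chain inside `S` is a chain inside every larger family `T ⊇ S`. [folklore] -/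
theorem Linked.mono {S T : Finset (Pt d)} (hST : S ⊆ T) {x y : Pt d} (h : Linked S x y) : Linked T x y := by
  unfold Linked at *
  induction h with
  | refl => exact Relation.ReflTransGen.refl
  | tail _ hbc ih => exact Relation.ReflTransGen.tail ih ⟨hST hbc.1, hST hbc.2.1, hbc.2.2⟩

/-- One common-wall step inside `S` is a chain. [folklore] -/
theorem linked_of_stepIn {S : Finset (Pt d)} {x y : Pt d} (h : StepIn S x y) : Linked S x y :=
  Relation.ReflTransGen.single h

/-- The cube □̃ = □̃¹ of [Balaban1987RG1] p. 257 (*"we define □̃ⁿ as a cube of the size (1 + 2n)M and with a center at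
the center of □"*), n = 1, as the family of the 3^d cubes of index within sup-distance 1 of `c`. [cite: Balaban1987RG1, p.257 (definition of □̃ⁿ)] -/
def block (c : Pt d) : Finset (Pt d) := Fintype.piFinset fun i => Finset.Icc (c i - 1) (c i + 1)

/-- The cubes of □̃ (centre c) are those of index y with |y_i − c_i| ≤ 1 for all i. [folklore] -/
theorem mem_block {c y : Pt d} : y ∈ block c ↔ ∀ i, c i - 1 ≤ y i ∧ y i ≤ c i + 1 := by
  simp [block, Fintype.mem_piFinset, Finset.mem_Icc]

/-- □ is one of the cubes of □̃. [folklore] -/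
theorem mem_block_self (c : Pt d) : c ∈ block c :=
  mem_block.mpr fun i => ⟨by linarith, by linarith⟩

/-- □̃ consists of 3^d cubes (side (1 + 2·1)M, [Balaban1987RG1] p. 257). [folklore] -/
theorem card_block (c : Pt d) : (block c).card = 3 ^ d := by
  rw [block, Fintype.card_piFinset]
  have h : ∀ i : Fin d, (Finset.Icc (c i - 1) (c i + 1)).card = 3 := by
    intro i
    rw [Int.card_Icc]
    have : c i + 1 + 1 - (c i - 1) = 3 := by ring
    rw [this]
    rfl
  simp [h, Finset.prod_const, Finset.card_univ, Fintype.card_fin]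

/-- X̃ = X̃¹: the domain X with one layer of cubes adjoined ([Balaban1987RG1] p. 257 *"The meaning of the symbol X̃ⁿ
should be obvious"*; p. 262: *"The domain X̃⁻² is obtained from X by taking away two layers of cubes from π_j, which are
closest to the boundary of X. Thus it is a domain X′ such that X̃′² = X."*), i.e. the union of the □̃ over the cubes □
of X. [cite: Balaban1987RG1, p.257 (definition of X̃ⁿ)] -/
def collar (S : Finset (Pt d)) : Finset (Pt d) := S.biUnion block

/-- X ⊆ X̃. [folklore] -/
theorem subset_collar (S : Finset (Pt d)) : S ⊆ collar S :=
  fun x hx => Finset.mem_biUnion.mpr ⟨x, hx, mem_block_self x⟩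

/-- □̃ ⊆ X̃ for every cube □ of X. [folklore] -/
theorem block_subset_collar {S : Finset (Pt d)} {c : Pt d} (hc : c ∈ S) : block c ⊆ collar S :=
  Finset.subset_biUnion_of_mem block hc

/-- |X̃| ≤ 3^d |X|. [folklore] -/
theorem card_collar_le (S : Finset (Pt d)) : (collar S).card ≤ 3 ^ d * S.card := by
  calc (collar S).card ≤ ∑ c ∈ S, (block c).card := Finset.card_biUnion_le
    _ = ∑ c ∈ S, 3 ^ d := by simp [card_block]
    _ = 3 ^ d * S.card := by rw [Finset.sum_const, smul_eq_mul, mul_comm]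

/-- |X̃ ∖ X| + |X| ≤ 3^d |X| (each cube of X̃ lies in the □̃ of a cube of X). [folklore] -/
theorem card_collar_sdiff_add_le (S : Finset (Pt d)) : (collar S \ S).card + S.card ≤ 3 ^ d * S.card := by
  rw [Finset.card_sdiff_add_card_eq_card (subset_collar S)]
  exact card_collar_le S

/-- The counting step of the substitute chain: |X̃ ∖ X| ≤ (3^d − 1)|X|, as real numbers. [folklore] -/
theorem card_collar_sdiff_le (S : Finset (Pt d)) : ((collar S \ S).card : ℝ) ≤ (3 ^ d - 1) * S.card := by
  have h := card_collar_sdiff_add_le S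
  have h' : ((collar S \ S).card : ℝ) + (S.card : ℝ) ≤ (3 : ℝ) ^ d * S.card := by exact_mod_cast h
  linarith

/-- Auxiliary chain inside □̃: the cube whose first `j` index coordinates are those of `y` and the others those of
`c` (so the coordinates of `c` are changed into those of `y` one at a time). [folklore] -/
def pref (c y : Pt d) (j : ℕ) : Pt d := fun i => if (i : ℕ) < j then y i else c i

/-- The chain starts at `c`. [folklore] -/
theorem pref_zero (c y : Pt d) : pref c y 0 = c := by
  funext i; simp [pref]

/-- The chain ends at `y` (from step `d` on). [folklore] -/
theorem pref_eq_of_le {c y : Pt d} {j : ℕ} (hj : d ≤ j) : pref c y j = y := by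
  funext i; simp [pref, lt_of_lt_of_le i.isLt hj]

/-- The chain stays inside □̃ when `y` is a cube of □̃ (centre c). [folklore] -/
theorem pref_mem_block {c y : Pt d} (hy : y ∈ block c) (j : ℕ) : pref c y j ∈ block c := by
  rw [mem_block] at hy ⊢
  intro i
  by_cases h : (i : ℕ) < j
  · simp [pref, h, hy i]
  · simp only [pref, h, if_false]
    constructor <;> linarith

/-- Consecutive cubes of the chain differ only in the index coordinate `j`. [folklore] -/
theorem pref_succ (c y : Pt d) {j : ℕ} (hj : j < d) :
    pref c y (j + 1) = Function.update (pref c y j) ⟨j, hj⟩ (y ⟨j, hj⟩) := by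
  funext i
  by_cases hi : i = ⟨j, hj⟩
  · subst hi
    simp [pref]
  · have hne : (i : ℕ) ≠ j := fun h => hi (Fin.ext h)
    rw [Function.update_of_ne hi]
    simp only [pref]
    split_ifs <;> first | rfl | omega

/-- The centre `c` of □̃ is chain-connected inside □̃ to every cube of the chain towards `y ∈ □̃`. [folklore] -/
theorem linked_block_pref {c y : Pt d} (hy : y ∈ block c) : ∀ j : ℕ, Linked (block c) c (pref c y j) := by
  intro j
  induction j with
  | zero =>
    rw [pref_zero]
    exact Relation.ReflTransGen.refl
  | succ j ih =>
    by_cases hj : j < d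
    · refine ih.trans ?_
      have hmem0 : pref c y j ∈ block c := pref_mem_block hy j
      have hmem1 : pref c y (j + 1) ∈ block c := pref_mem_block hy (j + 1)
      have hci : pref c y j ⟨j, hj⟩ = c ⟨j, hj⟩ := by simp [pref]
      have hyi := (mem_block.mp hy) ⟨j, hj⟩
      rcases (by omega : y ⟨j, hj⟩ = c ⟨j, hj⟩ + 1 ∨ y ⟨j, hj⟩ = c ⟨j, hj⟩ - 1 ∨ y ⟨j, hj⟩ = c ⟨j, hj⟩)
        with h | h | h
      · have hadj : Adj (pref c y j) (pref c y (j + 1)) := by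
          rw [pref_succ c y hj, h, ← hci]
          exact adj_update_add_one _ _
        exact linked_of_stepIn ⟨hmem0, hmem1, hadj⟩
      · have hadj : Adj (pref c y j) (pref c y (j + 1)) := by
          rw [pref_succ c y hj, h, ← hci]
          exact adj_update_sub_one _ _
        exact linked_of_stepIn ⟨hmem0, hmem1, hadj⟩
      · have heq : pref c y (j + 1) = pref c y j := by
          rw [pref_succ c y hj, h, ← hci, Function.update_eq_self]
        rw [heq]
        exact Relation.ReflTransGen.refl
    · have h1 : pref c y (j + 1) = y := pref_eq_of_le (by omega)
      have h0 : pref c y j = y := pref_eq_of_le (by omega)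
      rw [h1]
      rw [h0] at ih
      exact ih

/-- Every cube of □̃ is chain-connected to □ inside □̃. [folklore] -/
theorem linked_block_center {c y : Pt d} (hy : y ∈ block c) : Linked (block c) c y := by
  have h := linked_block_pref hy d
  rwa [pref_eq_of_le le_rfl] at h

/-- X̃ is a localization domain (a connected family) whenever X is — PROVED on the index model (used silently on p. 19
of [Balaban1988RG2Cluster], where Z′_i is *"the smallest localization domain from 𝐃_{k+1} containing Z̃_i"*). [folklore] -/
theorem faceConnected_collar {S : Finset (Pt d)} (hS : FaceConnected S) : FaceConnected (collar S) := by
  intro x hx y hy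
  obtain ⟨c, hc, hxc⟩ : ∃ c ∈ S, x ∈ block c := by simpa [collar] using hx
  obtain ⟨c', hc', hyc'⟩ : ∃ c' ∈ S, y ∈ block c' := by simpa [collar] using hy
  have h1 : Linked (collar S) x c := ((linked_block_center hxc).mono (block_subset_collar hc)).symm
  have h2 : Linked (collar S) c c' := (hS c hc c' hc').mono (subset_collar S)
  have h3 : Linked (collar S) c' y := (linked_block_center hyc').mono (block_subset_collar hc')
  exact (h1.trans h2).trans h3

/-- The π_{k+1}-cube containing a π_k-cube: π_{k+1}-cubes are blocks of L^d cubes of π_k ([Balaban1988RG2Cluster] p. 13,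
verbatim: *"we take cubes from π_{k+1}, i.e. cubes of the size LM in the scale corresponding to the lattice T_η"*); the
index b of the block containing the cube of index x is b_μ = ⌊x_μ/L⌋ (`coarse_eq_iff`). [cite: Balaban1988RG2Cluster, p.13 (cubes of the size LM)] -/
def coarse (L : ℕ) (x : Pt d) : Pt d := fun i => x i / (L : ℤ)

/-- The π_{k+1}-cube of index b consists of the π_k-cubes of index x with Lb_i ≤ x_i < L(b_i + 1): the blocks are
cubes of side L (in π_k units) partitioning the lattice. [folklore] -/
theorem coarse_eq_iff {L : ℕ} (hL : 0 < L) (x b : Pt d) :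
    coarse L x = b ↔ ∀ i, (L : ℤ) * b i ≤ x i ∧ x i < (L : ℤ) * (b i + 1) := by
  have hL' : (0 : ℤ) < (L : ℤ) := by exact_mod_cast hL
  constructor
  · intro h i
    have hi : x i / (L : ℤ) = b i := by rw [← h]; rfl
    constructor
    · have := (Int.le_ediv_iff_mul_le hL').mp hi.symm.le
      linarith [mul_comm (b i) (L : ℤ)]
    · have := (Int.ediv_lt_iff_lt_mul hL').mp (hi.le.trans_lt (lt_add_one (b i)))
      linarith [mul_comm (b i + 1) (L : ℤ)]
  · intro h
    funext i
    obtain ⟨h1, h2⟩ := h i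
    apply le_antisymm
    · have : x i / (L : ℤ) < b i + 1 :=
        (Int.ediv_lt_iff_lt_mul hL').mpr (by linarith [mul_comm (b i + 1) (L : ℤ)])
      exact Int.lt_add_one_iff.mp this
    · exact (Int.le_ediv_iff_mul_le hL').mpr (by linarith [mul_comm (b i) (L : ℤ)])

/-- Z ↦ the index set (in π_{k+1}) of the union of the smallest family of π_{k+1}-cubes containing Z ([Balaban1988RG2Cluster]
p. 13, verbatim: *"Z′₀ is a union of the smallest family of such cubes containing Z̃₀"*; p. 19: *"we denote by Z′_i the
smallest localization domain from 𝐃_{k+1} containing Z̃_i"* — the same set when the argument is connected,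
`faceConnected_closureIdx`); = [Dimock2013] §3: *"If X ∈ 𝒟_k let X̄ ∈ 𝒟⁰_{k+1} be the union of all LM cubes
intersecting X"*.  Applied below to Z̃ = `collar Z`, giving Z′. [cite: Balaban1988RG2Cluster, p.13/p.19 (definition of Z′)] -/
def closureIdx (L : ℕ) (S : Finset (Pt d)) : Finset (Pt d) := S.image (coarse L)

/-- Z′ is non-empty when Z is. [folklore] -/
theorem closureIdx_nonempty {L : ℕ} {S : Finset (Pt d)} (hS : S.Nonempty) : (closureIdx L S).Nonempty :=
  hS.image _

/-- Integer division: ⌊(a + 1)/L⌋ is ⌊a/L⌋ or ⌊a/L⌋ + 1 (L ≥ 1). [folklore] -/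
theorem ediv_add_one_cases {L : ℕ} (hL : 0 < L) (a : ℤ) :
    (a + 1) / (L : ℤ) = a / L ∨ (a + 1) / (L : ℤ) = a / L + 1 := by
  have hL' : (0 : ℤ) < L := by exact_mod_cast hL
  have h1 : a / (L : ℤ) ≤ (a + 1) / L := Int.ediv_le_ediv hL' (by linarith)
  have h2 : (a + 1) / (L : ℤ) ≤ a / L + 1 := by
    have h := Int.ediv_le_ediv hL' (show a + 1 ≤ a + 1 * (L : ℤ) by linarith)
    rwa [Int.add_mul_ediv_right _ _ hL'.ne'] at h
  omega

/-- Moving a π_k-cube by e_i moves its π_{k+1}-block by 0 or by e_i. [folklore] -/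
theorem coarse_update_add_one {L : ℕ} (hL : 0 < L) (x : Pt d) (i : Fin d) :
    coarse L (Function.update x i (x i + 1)) = coarse L x ∨
      coarse L (Function.update x i (x i + 1)) = Function.update (coarse L x) i (coarse L x i + 1) := by
  rcases ediv_add_one_cases hL (x i) with h | h
  · left
    funext j
    by_cases hj : j = i
    · subst hj; simp [coarse, h]
    · simp [coarse, Function.update_of_ne hj]
  · right
    funext j
    by_cases hj : j = i
    · subst hj; simp [coarse, h]
    · simp [coarse, Function.update_of_ne hj]

/-- Cubes with a common wall lie in the same π_{k+1}-cube or in π_{k+1}-cubes with a common wall. [folklore] -/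
theorem coarse_adj {L : ℕ} (hL : 0 < L) {x y : Pt d} (h : Adj x y) :
    coarse L x = coarse L y ∨ Adj (coarse L x) (coarse L y) := by
  obtain ⟨i, h | h⟩ := h
  · rcases coarse_update_add_one hL x i with h' | h'
    · left; rw [h, h']
    · right; rw [h, h']; exact adj_update_add_one _ _
  · rcases coarse_update_add_one hL y i with h' | h'
    · left; rw [h, h']
    · right; rw [h, h']; exact (adj_update_add_one _ _).symm

/-- The smallest family of π_{k+1}-cubes containing a connected family of π_k-cubes is connected ("the smallest
localization domain from 𝐃_{k+1} containing" it, p. 19, is the union of that family, p. 13) — PROVED on the index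
model. [folklore] -/
theorem faceConnected_closureIdx {L : ℕ} (hL : 0 < L) {S : Finset (Pt d)} (hS : FaceConnected S) :
    FaceConnected (closureIdx L S) := by
  have key : ∀ {u v : Pt d}, Linked S u v → Linked (closureIdx L S) (coarse L u) (coarse L v) := by
    intro u v huv
    unfold Linked at huv ⊢
    induction huv with
    | refl => exact Relation.ReflTransGen.refl
    | tail _ hbc ih =>
      rcases coarse_adj hL hbc.2.2 with h | h
      · rw [← h]; exact ih
      · exact ih.tail ⟨Finset.mem_image_of_mem _ hbc.1, Finset.mem_image_of_mem _ hbc.2.1, h⟩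
  intro a ha b hb
  obtain ⟨x, hx, rfl⟩ := Finset.mem_image.mp ha
  obtain ⟨y, hy, rfl⟩ := Finset.mem_image.mp hb
  exact key (hS x hx y hy)

/-- Z′ (the smallest family of π_{k+1}-cubes containing Z̃) is a localization domain from 𝐃_{k+1} whenever Z is one
from 𝐃_k (p. 19: *"the smallest localization domain from 𝐃_{k+1} containing Z̃_i"*) — PROVED on the index model. [folklore] -/
theorem faceConnected_closure {L : ℕ} (hL : 0 < L) {Z : Finset (Pt d)} (hZ : FaceConnected Z) :
    FaceConnected (closureIdx L (collar Z)) :=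
  faceConnected_closureIdx hL (faceConnected_collar hZ)

/-! ## Part 2. The tree length d_j: NOT formalised — three published statements entered as quoted leaves

`tl X` stands for Bałaban's d_j(X) ([Balaban1987RG1] p. 257, verbatim: *"Consider a class of tree graphs contained in X
and intersecting all the cubes in X. A length of a shortest graph in this class, divided by M, is the linear size of X,
and is denoted by d_j(X). Thus we rescale the space, so that cubes from π_j become unit cubes, and we take the distance
in this scale. Let us stress the fact that we consider graphs in the continuous space"*) = [Dimock2013] §3 *"M d_M(X) =
the length of the shortest tree in X joining the M-cubes in X. Here the tree is in the continuum torus"*, read on index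
sets (scale-free by the quoted rescaling; [Dimock2013] §3: *"Since d_{LM}(LX) = d_M(X)"*).  `ell`, `ellt` stand for
[Dimock2013BalabanII] App. E's ℓ_M, ℓ̃_M: *"M ℓ_M(Y) is the length of a minimal tree whose vertices are one point
from each block in Y. M ℓ̃_M(Y) is the length of a minimal tree whose vertices are one point from each block in Y
and possibly other points."*  Nothing is assumed about these functions except through the named leaves below. -/

/-- LEAF 1 (published, proved) — [Dimock2013] §3, proof of Lemma 10 (reblocking), first sentence, verbatim: *"If X̄ = Y
then a minimal tree on the M blocks in X is also a tree on the LM blocks in Y and so M d_M(X) ≥ LM d_{LM}(Y)"* (with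
*"d_{LM}(LX) = d_M(X)"*, ibid.): exact coarsening, factor L.  Stated in [Dimock2013]'s d = 3 setting; the quoted
argument (a tree inside X meeting every M-cube of X lies inside X̄ ⊇ X and meets every LM-cube of X̄, each of which
contains an M-cube of X) names no dimension — HYPOTHESIS here, not asserted. [cite: Dimock2013, §3 Lemma 10 (reblocking), proof l.1] -/
def CoarseningLeaf (d L : ℕ) (tl : Finset (Pt d) → ℝ) : Prop :=
  ∀ X : Finset (Pt d), X.Nonempty → FaceConnected X → (L : ℝ) * tl (closureIdx L X) ≤ tl X

/-- LEAF 2 (published, proved) — [Dimock2013] §4, Lemma 20, verbatim: *"For X, Y ∈ 𝒟_k and X ⊂ Y: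
M d_M(Y) ≤ M|Y − X|_M + M d_M(X)"* (proof ibid.: extend a minimal tree of X across two-dimensional [(d−1)-dimensional]
faces, one segment of length M per cube of Y − X).  Stated in [Dimock2013]'s d = 3 setting — HYPOTHESIS here. [cite: Dimock2013, §4 Lemma 20] -/
def AdjoinLeaf (d : ℕ) (tl : Finset (Pt d) → ℝ) : Prop :=
  ∀ X Y : Finset (Pt d), X.Nonempty → X ⊆ Y → FaceConnected X → FaceConnected Y →
    tl Y ≤ ((Y \ X).card : ℝ) + tl X

/-- LEAF 3a (published, proved) — [Dimock2013BalabanII] Appendix E, Lemma E.1 (1), verbatim: *"ℓ_M(Y) ≤ 2ℓ̃_M(Y)"*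
(for *"a collection of M-blocks □ in a lattice of dimension d. Y is not necessarily connected"*; proof ibid. after
[DIS73]). HYPOTHESIS here. [cite: Dimock2013BalabanII, App. E Lemma E.1(1)] -/
def SteinerLeaf (d : ℕ) (ell ellt : Finset (Pt d) → ℝ) : Prop :=
  ∀ Y : Finset (Pt d), Y.Nonempty → ell Y ≤ 2 * ellt Y

/-- LEAF 3b (published, proved) — [Dimock2013BalabanII] Appendix E, Lemma E.1 (3), verbatim: *"|Y|_M ≤ 4(2^d + 1)(ℓ_M(Y)
+ 1)"* (any collection Y of M-blocks in a lattice of dimension d; proof ibid.: *"at most 2^d blocks [can] be mutually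
touching"*, sup-metric). HYPOTHESIS here. [cite: Dimock2013BalabanII, App. E Lemma E.1(3)] -/
def VolumeLeaf (d : ℕ) (ell : Finset (Pt d) → ℝ) : Prop :=
  ∀ Y : Finset (Pt d), Y.Nonempty → (Y.card : ℝ) ≤ 4 * (2 ^ d + 1) * (ell Y + 1)

/-- LEAF 3c (published) — [Dimock2013BalabanII] Appendix E, preamble of Lemma E.1, verbatim: *"If Y is connected then
ℓ̃_M(Y) differs slightly from d_M(Y) defined in part I, since the latter requires a minimal tree to lie in Y. But we do
have ℓ̃_M(Y) ≤ d_M(Y)."* HYPOTHESIS here. [cite: Dimock2013BalabanII, App. E (preamble of Lemma E.1)] -/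
def InsideLeaf (d : ℕ) (ellt tl : Finset (Pt d) → ℝ) : Prop :=
  ∀ Y : Finset (Pt d), Y.Nonempty → FaceConnected Y → ellt Y ≤ tl Y

/-- Volume versus tree length for localization domains, DERIVED from Leaves 3a–3c: |Y| ≤ 4(2^d + 1)(2d(Y) + 1)
(d = 4: |Y| ≤ 136 d(Y) + 68; the repaired shape "N ≤ c(d_k + 1)" of the false-as-printed lower half of (2.30),
cell GAPS.md G-B13-07, with a published constant). [cite: Dimock2013BalabanII, App. E Lemma E.1] -/
theorem volume_le_of_leaves {ell ellt tl : Finset (Pt d) → ℝ} (hS : SteinerLeaf d ell ellt) (hV : VolumeLeaf d ell)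
    (hI : InsideLeaf d ellt tl) {Y : Finset (Pt d)} (hY : Y.Nonempty) (hc : FaceConnected Y) :
    (Y.card : ℝ) ≤ 4 * (2 ^ d + 1) * (2 * tl Y + 1) := by
  have h1 := hV Y hY
  have h2 := hS Y hY
  have h3 := hI Y hY hc
  have h2d : (0 : ℝ) ≤ 4 * (2 ^ d + 1) := by positivity
  calc (Y.card : ℝ) ≤ 4 * (2 ^ d + 1) * (ell Y + 1) := h1
    _ ≤ 4 * (2 ^ d + 1) * (2 * tl Y + 1) := by
        apply mul_le_mul_of_nonneg_left _ h2d
        linarith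

/-! ## Part 3. The substitute for (2.36), with explicit constants -/

/-- A scale-transfer inequality of the shape "L d_{k+1}(Z′) ≤ A d_k(Z) + B for every localization domain Z ∈ 𝐃_k",
Z′ = *"the smallest localization domain from 𝐃_{k+1} containing"* Z̃ (p. 19). The printed (2.36) is the case (A, B) = (2, 0)
(`Ineq236Printed`); the substitute proved below is (A, B) = (`Acoef d`, `Bcoef d`). [cite: Balaban1988RG2Cluster, (2.36) p.19] -/
def ScaleTransfer (d L : ℕ) (tl : Finset (Pt d) → ℝ) (A B : ℝ) : Prop :=
  ∀ Z : Finset (Pt d), Z.Nonempty → FaceConnected Z →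
    (L : ℝ) * tl (closureIdx L (collar Z)) ≤ A * tl Z + B

/-- (2.36) p. 19 [19] AS PRINTED, verbatim: *"2d_k(Z_i) ≧ Ld_{k+1}(Z′_i). (2.36) This inequality can be obtained by
simple, but awkward, geometric and combinatoric considerations. It follows by considering locally many possible
cases."* — typed for the record ONLY (cell GAPS.md G-B13-09: unproved in print; false for small L, e.g. L = 3,
Z_i = □̃; plausible but unverified for L odd > 11); NOT used in this module. [cite: Balaban1988RG2Cluster, (2.36) p.19] -/
def Ineq236Printed (d L : ℕ) (tl : Finset (Pt d) → ℝ) : Prop := ScaleTransfer d L tl 2 0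

/-- The multiplicative constant of the substitute: A_d = 1 + 8(3^d − 1)(2^d + 1). [cite: Balaban1988RG2Cluster, (2.36) p.19] -/
def Acoef (d : ℕ) : ℝ := 1 + 8 * (3 ^ d - 1) * (2 ^ d + 1)

/-- The additive constant of the substitute: B_d = 4(3^d − 1)(2^d + 1). [cite: Balaban1988RG2Cluster, (2.36) p.19] -/
def Bcoef (d : ℕ) : ℝ := 4 * (3 ^ d - 1) * (2 ^ d + 1)

/-- d = 4: A₄ = 1 + 8·80·17 = 10881. [folklore] -/
theorem Acoef_four : Acoef 4 = 10881 := by norm_num [Acoef]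

/-- d = 4: B₄ = 4·80·17 = 5440. [folklore] -/
theorem Bcoef_four : Bcoef 4 = 5440 := by norm_num [Bcoef]

/-- A_d > 0. [folklore] -/
theorem Acoef_pos (d : ℕ) : 0 < Acoef d := by
  have h3 : (1 : ℝ) ≤ 3 ^ d := one_le_pow₀ (by norm_num)
  have : (0 : ℝ) ≤ 8 * (3 ^ d - 1) * (2 ^ d + 1) := by
    apply mul_nonneg (mul_nonneg (by norm_num) (by linarith)) (by positivity)
  unfold Acoef; linarith

/-- B_d ≥ 0. [folklore] -/
theorem Bcoef_nonneg (d : ℕ) : 0 ≤ Bcoef d := by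
  have h3 : (1 : ℝ) ≤ 3 ^ d := one_le_pow₀ (by norm_num)
  unfold Bcoef
  apply mul_nonneg (mul_nonneg (by norm_num) (by linarith)) (by positivity)

/-- 2B_d < A_d, so the additive loss B_d/A_d is below ½ in every dimension. [folklore] -/
theorem two_Bcoef_lt_Acoef (d : ℕ) : 2 * Bcoef d < Acoef d := by
  unfold Acoef Bcoef; linarith

/-- THE SUBSTITUTE FOR (2.36), kernel-checked from the three published leaves and the proved cube combinatorics
(TEMPLATE.md §15.1 G4(b)): for every localization domain Z ∈ 𝐃_k,
  L·d_{k+1}(Z′) ≤ d_k(Z̃) ≤ |Z̃ ∖ Z| + d_k(Z) ≤ (3^d − 1)|Z| + d_k(Z) ≤ (3^d − 1)·4(2^d + 1)(2d_k(Z) + 1) + d_k(Z)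
  = A_d·d_k(Z) + B_d.
For d = 4: L·d_{k+1}(Z′) ≤ 10881·d_k(Z) + 5440 (`scaleTransfer_four`), in place of the printed L·d_{k+1}(Z′) ≤ 2d_k(Z). [cite: Balaban1988RG2Cluster, (2.36) p.19] -/
theorem scaleTransfer_of_leaves {L : ℕ} {tl ell ellt : Finset (Pt d) → ℝ} (hC : CoarseningLeaf d L tl)
    (hA : AdjoinLeaf d tl) (hS : SteinerLeaf d ell ellt) (hV : VolumeLeaf d ell) (hI : InsideLeaf d ellt tl) :
    ScaleTransfer d L tl (Acoef d) (Bcoef d) := by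
  intro Z hZ hc
  have hZc : (collar Z).Nonempty := hZ.mono (subset_collar Z)
  have hcc : FaceConnected (collar Z) := faceConnected_collar hc
  have h1 : (L : ℝ) * tl (closureIdx L (collar Z)) ≤ tl (collar Z) := hC (collar Z) hZc hcc
  have h2 : tl (collar Z) ≤ ((collar Z \ Z).card : ℝ) + tl Z := hA Z (collar Z) hZ (subset_collar Z) hc hcc
  have h3 : ((collar Z \ Z).card : ℝ) ≤ (3 ^ d - 1) * Z.card := card_collar_sdiff_le Z
  have h4 : (Z.card : ℝ) ≤ 4 * (2 ^ d + 1) * (2 * tl Z + 1) := volume_le_of_leaves hS hV hI hZ hc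
  have h3d : (0 : ℝ) ≤ 3 ^ d - 1 := by
    have : (1 : ℝ) ≤ 3 ^ d := one_le_pow₀ (by norm_num)
    linarith
  have h5 : (3 ^ d - 1 : ℝ) * Z.card ≤ (3 ^ d - 1) * (4 * (2 ^ d + 1) * (2 * tl Z + 1)) :=
    mul_le_mul_of_nonneg_left h4 h3d
  have key : (L : ℝ) * tl (closureIdx L (collar Z)) ≤ tl Z + (3 ^ d - 1) * (4 * (2 ^ d + 1) * (2 * tl Z + 1)) := by
    linarith
  have expand : tl Z + (3 ^ d - 1 : ℝ) * (4 * (2 ^ d + 1) * (2 * tl Z + 1)) = Acoef d * tl Z + Bcoef d := by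
    unfold Acoef Bcoef; ring
  linarith [key, expand]

/-- d = 4 instance: L·d_{k+1}(Z′) ≤ 10881·d_k(Z) + 5440 for every localization domain Z. [cite: Balaban1988RG2Cluster, (2.36) p.19] -/
theorem scaleTransfer_four {L : ℕ} {tl ell ellt : Finset (Pt 4) → ℝ} (hC : CoarseningLeaf 4 L tl)
    (hA : AdjoinLeaf 4 tl) (hS : SteinerLeaf 4 ell ellt) (hV : VolumeLeaf 4 ell) (hI : InsideLeaf 4 ellt tl) :
    ScaleTransfer 4 L tl 10881 5440 := by
  have h := scaleTransfer_of_leaves hC hA hS hV hI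
  rwa [Acoef_four, Bcoef_four] at h

/-- How (2.36) is USED (p. 19–20: *"The remaining exponential is bounded using the following inequality"*): from
L·t′ ≤ A·t + B one gets, for every rate a ≥ 0, e^{−a t} ≤ e^{aB/A}·e^{−(aL/A) t′} — the decay in d_k becomes decay in
d_{k+1} with factor L/A (printed: L/2) at the price of the constant e^{aB/A} (printed: none). Real arithmetic. [cite: Balaban1988RG2Cluster, p.19–20 ((2.36) ⇒ (2.37))] -/
theorem exp_transfer {Lr A B a t t' : ℝ} (hA : 0 < A) (ha : 0 ≤ a) (h : Lr * t' ≤ A * t + B) :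
    Real.exp (-(a * t)) ≤ Real.exp (a * B / A) * Real.exp (-(a * Lr / A * t')) := by
  rw [← Real.exp_add, Real.exp_le_exp]
  have h1 : a * (Lr * t') ≤ a * (A * t + B) := mul_le_mul_of_nonneg_left h ha
  have h2 : a * Lr / A * t' - a * B / A ≤ a * t := by
    rw [div_mul_eq_mul_div, ← sub_div, div_le_iff₀ hA]
    linarith
  linarith

/-- d = 4, per component Z_i of (2.35): for every rate a ≥ 0 (a = (1 − 6δ)κ on p. 19–20),
exp(−a d_k(Z_i)) ≤ e^{a/2} · exp(−(a L/10881) d_{k+1}(Z′_i)) — the substitute's version of the step the print describes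
in words (p. 19: *"We extract exp(− δκd_k(Z_i)) from each exponential in (2.35) … The remaining exponential is bounded
using the following inequality"* (2.36); p. 20 ll. 1–3: *"(1 − 5δ)κd_k(Z_i) in the exponentials replaced by
(1 − 6δ)½Lκd_{k+1}(Z′_i)"*), which in formulas (our rendering, not a printed display) is
exp(−(1−6δ)κd_k(Z_i)) ≤ exp(−(1−6δ)½Lκd_{k+1}(Z′_i)); the extra e^{a/2} ≤ e^{κ/2} joins the factors absorbed by the
smallness of ε₂ (cell census R18/R19). [cite: Balaban1988RG2Cluster, p.19–20 ((2.36) ⇒ (2.37))] -/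
theorem exp_transfer_four {L : ℕ} {tl : Finset (Pt 4) → ℝ} (hT : ScaleTransfer 4 L tl 10881 5440)
    {Z : Finset (Pt 4)} (hZ : Z.Nonempty) (hc : FaceConnected Z) {a : ℝ} (ha : 0 ≤ a) :
    Real.exp (-(a * tl Z)) ≤
      Real.exp (a / 2) * Real.exp (-(a * L / 10881 * tl (closureIdx L (collar Z)))) := by
  have h := exp_transfer (by norm_num : (0 : ℝ) < 10881) ha (hT Z hZ hc)
  have hB : Real.exp (a * 5440 / 10881) ≤ Real.exp (a / 2) := by
    rw [Real.exp_le_exp]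
    linarith
  exact h.trans (mul_le_mul_of_nonneg_right hB (Real.exp_pos _).le)

/-! ## Part 4. The closing bookkeeping of p. 21 with the substitute factor, against `B13.Consts` -/

/-- A decay bound of the shape (2.41) with an arbitrary constant K and rate r: ‖E^{(k+1)}(X)‖ ≤ K exp(−r d_{k+1}(X))
on Uᶜ_{k+1}(X, α₀, α₁); (2.41) as printed is K = O(1)C₃ε₁, r = (1 − 10δ)½Lκ (`bound241_iff_decayBound`). [cite: Balaban1988RG2Cluster, (2.41) p.21] -/
def DecayBound (S : B13.StepData) (K r : ℝ) : Prop :=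
  ∀ X φ, φ ∈ S.sp2 X → ‖S.Ek1 X φ‖ ≤ K * Real.exp (-(r * S.Dk1.dj X))

/-- (2.41) p. 21 as typed in `…B13` IS the decay bound with K = O(1)C₃ε₁ and r = (1 − 10δ)½Lκ (definitionally). [cite: Balaban1988RG2Cluster, (2.41) p.21] -/
theorem bound241_iff_decayBound (S : B13.StepData) (c : B13.Consts) :
    B13.Bound241 S c ↔ DecayBound S (c.A₂ * c.C3act * c.ε₁) ((1 - 10 * c.δ) * ((c.L : ℝ) / 2) * c.κ) :=
  Iff.rfl

/-- The substitute closing condition replacing the printed *"we assume that (1 − 10δ)½L = 1"* (p. 21): with the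
scale-transfer factor L/A in place of L/2 one needs (1 − 10δ)L/A ≥ 1. [cite: Balaban1988RG2Cluster, p.21 (after (2.41))] -/
def R22subst (c : B13.Consts) (A : ℝ) : Prop := 1 ≤ (1 - 10 * c.δ) * ((c.L : ℝ) / A)

/-- The printed choice is the case A = 2 of the substitute condition. [cite: Balaban1988RG2Cluster, p.21 (after (2.41))] -/
theorem R22subst_two_of_R22 (c : B13.Consts) (h : c.R22) : R22subst c 2 := by
  have h' : (1 - 10 * c.δ) * ((c.L : ℝ) / 2) = 1 := h
  unfold R22subst
  exact le_of_eq h'.symm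

/-- Under the substitute closing condition the final rate (1 − 10δ)(L/A)κ is at least κ (κ ≥ 0). [cite: Balaban1988RG2Cluster, p.21 (after (2.41))] -/
theorem kappa_le_rate_of_R22subst (c : B13.Consts) {A : ℝ} (h : R22subst c A) (hκ : 0 ≤ c.κ) :
    c.κ ≤ (1 - 10 * c.δ) * ((c.L : ℝ) / A) * c.κ := by
  have := mul_le_mul_of_nonneg_right h hκ
  linarith

/-- A decay bound with constant K ≤ ½E₀ and rate r ≥ κ gives (I.1.18) with ½E₀ and rate κ (uses d_{k+1}(X) ≥ 0,
`Setup.LocDomainSys.dj_nonneg`). Real arithmetic. [cite: Balaban1988RG2Cluster, p.21 (after (2.41))] -/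
theorem bound118_of_decayBound (S : B13.StepData) {K r E₀ κ : ℝ} (h : DecayBound S K r) (hK : K ≤ E₀ / 2)
    (hE : 0 ≤ E₀) (hr : κ ≤ r) : B13.Bound118 S.Dk1 S.sp2 S.Ek1 (E₀ / 2) κ := by
  intro X φ hφ
  have hd : 0 ≤ S.Dk1.dj X := S.Dk1.dj_nonneg X
  have hb := h X φ hφ
  have hexp0 : 0 ≤ Real.exp (-(r * S.Dk1.dj X)) := (Real.exp_pos _).le
  have hexp : Real.exp (-(r * S.Dk1.dj X)) ≤ Real.exp (-κ * S.Dk1.dj X) := by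
    rw [Real.exp_le_exp, neg_mul]
    exact neg_le_neg (mul_le_mul_of_nonneg_right hr hd)
  calc ‖S.Ek1 X φ‖ ≤ K * Real.exp (-(r * S.Dk1.dj X)) := hb
    _ ≤ E₀ / 2 * Real.exp (-(r * S.Dk1.dj X)) := mul_le_mul_of_nonneg_right hK hexp0
    _ ≤ E₀ / 2 * Real.exp (-κ * S.Dk1.dj X) := mul_le_mul_of_nonneg_left hexp (by linarith)

/-- p. 21 with the substitute factor: (2.41) with rate (1 − 10δ)(L/A)κ, the substitute closing condition `R22subst`,
and the last assumption "constant ≤ ½E₀" give (I.1.18) with ½E₀ for the terms of E^{(k+1)} — the analogue of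
`B13.bound118_of_bound241` (which is the case A = 2 with equality). [cite: Balaban1988RG2Cluster, p.21 (after (2.41))] -/
theorem bound118_of_substRate (S : B13.StepData) (c : B13.Consts) {A K : ℝ}
    (h241 : DecayBound S K ((1 - 10 * c.δ) * ((c.L : ℝ) / A) * c.κ)) (h22 : R22subst c A)
    (h23 : K ≤ c.E₀ / 2) (hE : 0 ≤ c.E₀) (hκ : 0 ≤ c.κ) :
    B13.Bound118 S.Dk1 S.sp2 S.Ek1 (c.E₀ / 2) c.κ :=
  bound118_of_decayBound S h241 h23 hE (kappa_le_rate_of_R22subst c h22 hκ)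

/-- Consistency with the sibling: the printed chain `B13.Bound241 ∧ R22 ∧ R23` is the case A = 2 of the above. [cite: Balaban1988RG2Cluster, p.21 (after (2.41))] -/
theorem bound118_of_bound241' (S : B13.StepData) (c : B13.Consts) (h241 : B13.Bound241 S c) (h22 : c.R22)
    (h23 : c.R23) (hE : 0 ≤ c.E₀) (hκ : 0 ≤ c.κ) : B13.Bound118 S.Dk1 S.sp2 S.Ek1 (c.E₀ / 2) c.κ :=
  bound118_of_substRate S c ((bound241_iff_decayBound S c).mp h241) (R22subst_two_of_R22 c h22) h23 hE hκ

/-- THE PRICE of the substitute: with δ > 0 (needed for (2.29)/(2.34), cell census R13) the condition (1 − 10δ)L/A ≥ 1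
forces L > A. [cite: Balaban1988RG2Cluster, p.21 (after (2.41))] -/
theorem lt_L_of_R22subst {Lr δ A : ℝ} (hA : 0 < A) (hδ : 0 < δ) (hL : 0 ≤ Lr)
    (h : 1 ≤ (1 - 10 * δ) * (Lr / A)) : A < Lr := by
  by_contra hcon
  have hle : Lr ≤ A := not_lt.mp hcon
  have h1 : Lr / A ≤ 1 := (div_le_one hA).mpr hle
  have h0 : 0 ≤ Lr / A := div_nonneg hL hA.le
  rcases h0.eq_or_lt with hx | hx
  · rw [← hx, mul_zero] at h
    linarith
  · have h2 : (1 - 10 * δ) * (Lr / A) < 1 * (Lr / A) := mul_lt_mul_of_pos_right (by linarith) hx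
    linarith

/-- d = 4: the substitute closing condition forces L ≥ 10882 (B12 p. 251 only asks "L an odd, positive integer > 11";
the printed factor ½ would allow every such L). [cite: Balaban1988RG2Cluster, p.21 (after (2.41))] -/
theorem R22subst_four_forces (c : B13.Consts) (hδ : 0 < c.δ) (h : R22subst c (Acoef 4)) : 10881 < c.L := by
  have hL : (0 : ℝ) ≤ (c.L : ℝ) := Nat.cast_nonneg _
  have hA : (0 : ℝ) < Acoef 4 := by rw [Acoef_four]; norm_num
  have key := lt_L_of_R22subst hA hδ hL h
  rw [Acoef_four] at key
  exact_mod_cast key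

/-- … and it IS satisfiable within B12's class "L odd > 11" with 0 < δ < 1/10: L = 21763 = 2·10881 + 1, δ = 1/20. [cite: Balaban1988RG2Cluster, p.21 (after (2.41))] -/
theorem R22subst_four_witness :
    ∃ L : ℕ, Odd L ∧ 11 < L ∧ ∃ δ : ℝ, 0 < δ ∧ δ < 1 / 10 ∧ 1 ≤ (1 - 10 * δ) * ((L : ℝ) / Acoef 4) :=
  ⟨21763, ⟨10881, by norm_num⟩, by norm_num, 1 / 20, by norm_num, by norm_num, by rw [Acoef_four]; norm_num⟩

end

end Literature.MathematicalPhysics.QuantumFieldTheory.Balaban1983to89.B13ScaleTransfer
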